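import Summits.CriticalPhenomena.PercolationContinuityZ3.Theorems.PercNearOneGluingNoHeavyLowerTailTwoCopyGraphBridge

/-!
# Two-copy bridge, SUPPORTED-FIBRE form: only the fibres inside the support of the weight matter

Support file for crux `stmt-CriticalPhenomena-4575` (master-family programme, quadratic four-point rows; vertex-cover class theorem of
`prim-bnk-1` gen 38, memo `run/shared/lean/prim/prim-l12/FROM-prim-bnk-1-gen38-VC-CLASS-THEOREM.md`).

`TwoCopyMono.sum_kernel_cell_nonneg_of_fibres` (`…TwoCopyGraphBridge`) asks for the nonnegativity of the antipodal count on EVERY fibre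
`(M, C)` of the complete graph on `Fin n`.  For restricted graph classes (weights vanishing on a prescribed set of pairs — e.g. the
vertex-cover class, where all pairs of non-terminals have weight `0`) the fibres meeting a zero-weight pair carry weight `0`
(`wt2_eq_zero_of_mem`), so only fibres with `M ∪ C` inside the support of `w` are needed:

* `sum_kernel_cell_nonneg_of_supported_fibres` — if `0 ≤ Σ_{T ⊆ M} liftK κ (prof (C ∪ T)) (prof (C ∪ (M ∖ T)))` for all disjoint `M, C`
  with `w e ≠ 0` for every `e ∈ C ∪ M`, then `0 ≤ Σ κᵢⱼ cellᵢ cellⱼ` for that weight `w`.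

This is the law-level entry point for the gen-38 certificates `VCCone.vcWord_botbot_nonneg_*` (which give the hypothesis on the
vertex-cover class once the supported fibres are identified with gadget words — the successor's bridge).  No sorries, no named facts, no
definitions; standard axioms.
-/

noncomputable section

namespace Summit.CriticalPhenomena.PercolationContinuityZ3.Theorems

open MeasureTheory Set Finset Literature.Probability.Percolation
open Literature.Probability.LatticeModels (prodBernoulli)

namespace TwoCopyMono

variable {n : ℕ}

/-- A fibre `(M, C)` containing a pair of weight zero has fibre weight zero. [this work] -/
theorem wt2_eq_zero_of_mem (w : Sym2 (Fin n) → unitInterval) {M C : Finset (Sym2 (Fin n))} {e : Sym2 (Fin n)}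
    (he : e ∈ C ∪ M) (hw : (w e : ℝ) = 0) : wt2 w M C = 0 := by
  classical
  unfold wt2
  refine Finset.prod_eq_zero (Finset.mem_univ e) ?_
  rcases Finset.mem_union.1 he with heC | heM
  · rw [if_pos heC, hw]; ring
  · by_cases heC : e ∈ C
    · rw [if_pos heC, hw]; ring
    · rw [if_neg heC, if_pos heM, hw]; ring

/-- **The bridge from SUPPORTED graph fibres.**  If the antipodal count of `κ` is nonnegative on every fibre `(M, C)` of `Fin n`
whose pairs all have nonzero weight under `w`, then the bilinear cell form of `κ` is nonnegative for `w`. [this work] -/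
theorem sum_kernel_cell_nonneg_of_supported_fibres {κ : Fin 15 → Fin 15 → ℤ} (a b c y : Fin n)
    (w : Sym2 (Fin n) → unitInterval)
    (hκ : ∀ (M C : Finset (Sym2 (Fin n))), Disjoint C M → (∀ e ∈ C ∪ M, (w e : ℝ) ≠ 0) →
      0 ≤ ∑ T ∈ M.powerset, liftK κ (prof a b c y ↑(C ∪ T)) (prof a b c y ↑(C ∪ (M \ T)))) :
    0 ≤ ∑ i : Fin 15, ∑ j : Fin 15, (κ i j : ℝ) * FourPointAtoms.cell w a b c y i * FourPointAtoms.cell w a b c y j := by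
  classical
  rw [sum_kernel_cell_eq_pairs, sum_pairs_eq_sum_fibres]
  refine Finset.sum_nonneg fun M _ => Finset.sum_nonneg fun C hC => ?_
  rw [Finset.mem_powerset] at hC
  have hCM : Disjoint C M := by
    rw [Finset.disjoint_left]; intro e heC heM; exact (Finset.mem_compl.1 (hC heC)) heM
  have hrw : ∀ T ∈ M.powerset,
      (liftK κ (prof a b c y ↑(C ∪ T)) (prof a b c y ↑(C ∪ (M \ T))) : ℝ) * (wt w (C ∪ T) * wt w (C ∪ (M \ T))) =
        wt2 w M C * (liftK κ (prof a b c y ↑(C ∪ T)) (prof a b c y ↑(C ∪ (M \ T))) : ℝ) := by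
    intro T hT
    rw [Finset.mem_powerset] at hT
    rw [wt_pair_eq w hT]; ring
  rw [Finset.sum_congr rfl hrw, ← Finset.mul_sum]
  by_cases hsupp : ∀ e ∈ C ∪ M, (w e : ℝ) ≠ 0
  · refine mul_nonneg (wt2_nonneg w M C) ?_
    have h := hκ M C hCM hsupp
    exact_mod_cast h
  · push Not at hsupp
    obtain ⟨e, he, hw⟩ := hsupp
    rw [wt2_eq_zero_of_mem w he hw, zero_mul]

end TwoCopyMono

end Summit.CriticalPhenomena.PercolationContinuityZ3.Theorems
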